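import Literature.NumberTheory.GaloisRepresentations.TateLevelOneHasseBridge
import Literature.NumberTheory.GaloisCohomology.BrauerHassePrincipleHolds
import Literature.NumberTheory.GaloisRepresentations.DecompositionGroupOfCompletion
import Literature.NumberTheory.GaloisRepresentations.MuCocycleKummerSplitting
import HarnessLib

/-!
# Hasse injectivity for `H²(Γ_K, ℤ/ℓ)` on the decomposition groups (explicit-cochain form)

Topic `NumberTheory/GaloisRepresentations`; namespace
`Literature.NumberTheory.GaloisRepresentations.ExplicitMuCocycles`.  Proof file: theorems only (no
definition, no instance, no named fact).

Let `K` be a number field containing a primitive `ℓ`-th root of unity, `ℓ` an odd prime, and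
`f : Γ_K × Γ_K → ℤ/ℓ` a locally constant `2`-cocycle (trivial coefficients).  If `f` is an explicit
coboundary on the decomposition group `D_{𝔓₀(v)} ≤ Γ_K` of EVERY finite place `v` (`𝔓₀(v)` the prime
of `\bar ℤ_K` cut out by `K̄ → \bar K_v`, `D_{𝔓₀(v)} = res_v(Γ_{K_v})`, Neukirch II (9.6)), then `f` is
an explicit coboundary on `Γ_K` (`coboundary_of_forall_coboundaryOn_decompositionSubgroup`).  This is
`H²(K, μ_ℓ) ↪ ⊕_v H²(K_v, μ_ℓ)`, i.e. Albert–Brauer–Hasse–Noether for `Br[ℓ]` together with the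
Kummer injection `H²(μ_ℓ) ↪ Br` (Hilbert 90), assembled from the tree exactly as in
`hasseInput_of_brauerHassePrinciple` (`TateLevelOneHasseBridge.lean`): the `K̄ˣ`-valued cocycle
`ζ^{ℓ f}` is locally trivial at the finite places (hypothesis, read on `Γ_{K_v}` through `res_v`) and
at the infinite places (`localSplitting_infinite_of_odd`, `ℓ` odd), hence a coboundary by the PROVED
fact `brauerHassePrinciple_holds K` (`BrauerHassePrincipleHolds.lean`); Hilbert 90 and an `ℓ`-th root
make the bounding cochain `μ_ℓ`-valued; exponents are read in `ℤ/ℓ ≅ (ℚ/ℤ)[ℓ]`.  It is the instance,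
at the full group of a number field, of the hypothesis (AxH) of the abstract Neukirch lemma
(`NeukirchAbstractContainment.lean`; abc-iut GAP-LEDGER G-L4d2g4-1, campaign L); classical; nothing
here bears on [IUTchIII] Cor. 3.12.

## References

* J. W. S. Cassels, A. Fröhlich (eds.), *Algebraic Number Theory* (1967), Ch. VII §9.6, §10.
  [CasselsFrohlichANT1967]
* J.-P. Serre, *Modular forms of weight one and Galois representations* (Durham 1977), §6.5 (a), (c).
  [SerreDurham1977]
* J. Neukirch, A. Schmidt, K. Wingberg, *Cohomology of Number Fields* (2008), (8.1.17), (12.1.9).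
  [NeukirchSchmidtWingberg2008]
-/

noncomputable section

open Function Field IsDedekindDomain NumberField

namespace Literature.NumberTheory.GaloisRepresentations.ExplicitMuCocycles

open Literature.NumberTheory.GaloisRepresentations Literature.NumberTheory.GaloisCohomology

/-- **Hasse injectivity for `H²(Γ_K, ℤ/ℓ)`, explicit form on the decomposition groups.**  `K` a number
field with a primitive `ℓ`-th root of unity, `ℓ` an odd prime; a locally constant `ℤ/ℓ`-valued
`2`-cocycle on `Γ_K` which is an explicit coboundary on `D_{𝔓₀(v)}` for every finite place `v` is an
explicit coboundary on `Γ_K`. [cite: NeukirchSchmidtWingberg2008, Thm (8.1.17)]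
[cite: CasselsFrohlichANT1967, Ch. VII §9.6 and §10] -/
theorem coboundary_of_forall_coboundaryOn_decompositionSubgroup (K : Type) [Field K] [NumberField K]
    {ℓ : ℕ} (hℓ : ℓ.Prime) (hℓ2 : ℓ ≠ 2) {ζ : K} (hζ : IsPrimitiveRoot ζ ℓ)
    (f : absoluteGaloisGroup K → absoluteGaloisGroup K → ZMod ℓ)
    (hlc : IsLocallyConstant (uncurry f))
    (hcoc : ∀ σ τ υ, f σ τ + f (σ * τ) υ = f τ υ + f σ (τ * υ))
    (hloc : ∀ v : HeightOneSpectrum (𝓞 K), ∃ γ : absoluteGaloisGroup K → ZMod ℓ,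
      IsLocallyConstant
        (fun s : ↥((adicCompletionPrime K v).decompositionSubgroup (absoluteGaloisGroup K)) => γ s) ∧
      ∀ a ∈ (adicCompletionPrime K v).decompositionSubgroup (absoluteGaloisGroup K),
        ∀ b ∈ (adicCompletionPrime K v).decompositionSubgroup (absoluteGaloisGroup K),
          f a b = γ a + γ b - γ (a * b)) :
    ∃ β : absoluteGaloisGroup K → ZMod ℓ, IsLocallyConstant β ∧
      ∀ σ τ, f σ τ = β σ + β τ - β (σ * τ) := by
  classical
  haveI : Fact ℓ.Prime := ⟨hℓ⟩
  haveI : NeZero ℓ := ⟨hℓ.ne_zero⟩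
  -- `ℤ/ℓ ≅ (ℚ/ℤ)[ℓ]`
  obtain ⟨e', he', -, he'surj⟩ := zmod_exists_addMonoidHom_addCircle hℓ.pos
  have he'ℓ : ∀ k : ZMod ℓ, ℓ • e' k = 0 := fun k => by
    rw [← map_nsmul, nsmul_eq_mul, ZMod.natCast_self, zero_mul, map_zero]
  -- the `(ℚ/ℤ)[ℓ]`-valued cocycle `z`
  set z : absoluteGaloisGroup K → absoluteGaloisGroup K → AddCircle (1 : ℚ) := fun σ τ => e' (f σ τ)
    with hzdef
  have hz_lc : IsLocallyConstant (uncurry z) := hlc.comp e'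
  have hz_coc : ∀ σ τ υ, z σ τ + z (σ * τ) υ = z τ υ + z σ (τ * υ) := fun σ τ υ => by
    simp only [hzdef, ← map_add, hcoc]
  have hz_p : ∀ σ τ, ℓ • z σ τ = 0 := fun σ τ => he'ℓ _
  -- `ζ ∈ K̄` and the exponential `m`
  set ζb : AlgebraicClosure K := algebraMap K _ ζ with hζb_def
  have hζb : IsPrimitiveRoot ζb ℓ := hζ.map_of_injective (algebraMap K _).injective
  have hζb0 : ζb ≠ 0 := hζb.ne_zero hℓ.ne_zero
  have hζb_fix : ∀ σ : absoluteGaloisGroup K, σ • ζb = ζb := fun σ => by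
    rw [absoluteGaloisGroup.smul_def, hζb_def, AlgEquiv.commutes]
  obtain ⟨m, hm_add, hm_inj, hm0, hm_pow, hm_range, hm_surj⟩ := exists_mulExp_of_isPrimitiveRoot hℓ.pos hζb
  have hm0' : ∀ x, m x ≠ 0 := fun x => by
    obtain ⟨k, hk⟩ := hm_range x
    rw [hk]
    exact pow_ne_zero _ hζb0
  have hm_fix : ∀ (ρ : absoluteGaloisGroup K) x, ρ • m x = m x := fun ρ x => by
    obtain ⟨k, hk⟩ := hm_range x
    rw [hk, smul_pow', hζb_fix]
  have hm_sub : ∀ x y, ℓ • x = 0 → ℓ • y = 0 → m (x - y) * m y = m x := fun x y hx hy => by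
    rw [← hm_add _ _ (by rw [nsmul_sub, hx, hy, sub_zero]) hy, sub_add_cancel]
  -- the `K̄`-valued cocycle `E = m ∘ z`
  set E : absoluteGaloisGroup K → absoluteGaloisGroup K → AlgebraicClosure K := fun σ τ => m (z σ τ)
    with hE_def
  have hE0 : ∀ σ τ, E σ τ ≠ 0 := fun σ τ => hm0' _
  have hE_lc : IsLocallyConstant (fun q : absoluteGaloisGroup K × absoluteGaloisGroup K => E q.1 q.2) :=
    hz_lc.comp m
  have hE_coc : ∀ σ τ υ, E σ τ * E (σ * τ) υ = σ • E τ υ * E σ (τ * υ) := fun σ τ υ => by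
    rw [hm_fix]
    simp only [hE_def]
    rw [← hm_add _ _ (hz_p _ _) (hz_p _ _), ← hm_add _ _ (hz_p _ _) (hz_p _ _), hz_coc]
  -- local conditions at the finite places, from the hypothesis on `D_{𝔓₀(v)} = res_v (Γ_{K_v})`
  have hfin : ∀ w : HeightOneSpectrum (𝓞 K),
      ∃ b : absoluteGaloisGroup (w.adicCompletion K) → AlgebraicClosure (w.adicCompletion K),
        IsLocallyConstant b ∧ (∀ x, b x ≠ 0) ∧
          ∀ x y, absClosureEmbedding K (w.adicCompletion K)
              (E (absGaloisRestrict K (w.adicCompletion K) x)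
                (absGaloisRestrict K (w.adicCompletion K) y)) =
            b x * x • b y / b (x * y) := by
    intro w
    obtain ⟨γ, hγ_lc, hγ⟩ := hloc w
    set D := (adicCompletionPrime K w).decompositionSubgroup (absoluteGaloisGroup K) with hDdef
    set ι := absClosureEmbedding K (w.adicCompletion K) with hι
    set r := absGaloisRestrict K (w.adicCompletion K) with hr
    have hrD : ∀ x, r x ∈ D := fun x => by
      rw [hDdef, decompositionSubgroup_adicCompletionPrime_eq_range]
      exact ⟨x, rfl⟩
    -- the `ℓ`-torsion splitting `β = e' ∘ γ ∘ r` on `Γ_{K_w}`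
    set β : absoluteGaloisGroup (w.adicCompletion K) → AddCircle (1 : ℚ) := fun x => e' (γ (r x))
      with hβdef
    have hβ_lc : IsLocallyConstant β := by
      have h1 : IsLocallyConstant (fun x : absoluteGaloisGroup (w.adicCompletion K) => γ (r x)) := by
        have h2 := hγ_lc.comp_continuous (f := fun x => (⟨r x, hrD x⟩ : D))
          (Continuous.subtype_mk r.continuous _)
        exact h2
      exact h1.comp e'
    have hβp : ∀ x, ℓ • β x = 0 := fun x => he'ℓ _
    have hβ : ∀ x y, z (r x) (r y) + β (x * y) = β x + β y := fun x y => by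
      simp only [hzdef, hβdef, ← map_add]
      rw [map_mul, hγ (r x) (hrD x) (r y) (hrD y)]
      congr 1
      ring
    have hι_fix : ∀ (x : absoluteGaloisGroup (w.adicCompletion K)) t, x • ι (m t) = ι (m t) := fun x t => by
      obtain ⟨k, hk⟩ := hm_range t
      rw [hk, map_pow, smul_pow', hι, hζb_def, AlgHom.commutes,
        IsScalarTower.algebraMap_apply K (w.adicCompletion K) (AlgebraicClosure (w.adicCompletion K)),
        absoluteGaloisGroup.smul_def, AlgEquiv.commutes]
    refine ⟨fun x => ι (m (β x)), hβ_lc.comp fun t => ι (m t), fun x => ?_, fun x y => ?_⟩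
    · exact (map_ne_zero ι).mpr (hm0' _)
    · rw [hι_fix]
      show ι (m (z (r x) (r y))) = ι (m (β x)) * ι (m (β y)) / ι (m (β (x * y)))
      have hzr : z (r x) (r y) = β x + β y - β (x * y) := eq_sub_of_add_eq (hβ x y)
      rw [hzr, eq_div_iff ((map_ne_zero ι).mpr (hm0' _)), ← map_mul, ← map_mul,
        hm_sub _ _ (by rw [nsmul_add, hβp, hβp, add_zero]) (hβp _), hm_add _ _ (hβp _) (hβp _)]
  -- local conditions at the infinite places (`ℓ` odd)
  have hinf : ∀ w : InfinitePlace K,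
      ∃ b : absoluteGaloisGroup w.Completion → AlgebraicClosure w.Completion,
        IsLocallyConstant b ∧ (∀ x, b x ≠ 0) ∧
          ∀ x y, absClosureEmbedding K w.Completion
              (E (absGaloisRestrict K w.Completion x) (absGaloisRestrict K w.Completion y)) =
            b x * x • b y / b (x * y) := by
    intro w
    set ι := absClosureEmbedding K w.Completion with hι
    set r := absGaloisRestrict K w.Completion with hr
    have hι_fix : ∀ (x : absoluteGaloisGroup w.Completion) t, x • ι (m t) = ι (m t) := fun x t => by
      obtain ⟨k, hk⟩ := hm_range t
      rw [hk, map_pow, smul_pow', hι, hζb_def, AlgHom.commutes,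
        IsScalarTower.algebraMap_apply K w.Completion (AlgebraicClosure w.Completion),
        absoluteGaloisGroup.smul_def, AlgEquiv.commutes]
    obtain ⟨β, hβ_lc, hβ, hβp⟩ : ∃ β : absoluteGaloisGroup w.Completion → AddCircle (1 : ℚ),
        IsLocallyConstant β ∧ (∀ x y, z (r x) (r y) + β (x * y) = β x + β y) ∧ ∀ x, ℓ • β x = 0 :=
      localSplitting_infinite_of_odd w hℓ hℓ2 (fun x y => z (r x) (r y))
        (hz_lc.comp_continuous (r.continuous.prodMap r.continuous))
        (fun x y u => by simpa only [map_mul] using hz_coc (r x) (r y) (r u)) (fun x y => hz_p _ _)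
    refine ⟨fun x => ι (m (β x)), hβ_lc.comp fun t => ι (m t), fun x => ?_, fun x y => ?_⟩
    · exact (map_ne_zero ι).mpr (hm0' _)
    · rw [hι_fix]
      show ι (m (z (r x) (r y))) = ι (m (β x)) * ι (m (β y)) / ι (m (β (x * y)))
      have hzr : z (r x) (r y) = β x + β y - β (x * y) := eq_sub_of_add_eq (hβ x y)
      rw [hzr, eq_div_iff ((map_ne_zero ι).mpr (hm0' _)), ← map_mul, ← map_mul,
        hm_sub _ _ (by rw [nsmul_add, hβp, hβp, add_zero]) (hβp _), hm_add _ _ (hβp _) (hβp _)]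
  -- Albert–Brauer–Hasse–Noether: `E = ∂b`
  obtain ⟨b, hb_lc, hb0, hb⟩ := brauerHassePrinciple_holds K E hE_lc hE0 hE_coc hfin hinf
  -- Kummer descent: `z = ∂B` with `B` locally constant `ℓ`-torsion
  obtain ⟨B, hB_lc, hBp, hzB⟩ := exists_nsmul_split_of_apply_eq_cob K (p := ℓ) hζb hζb_fix m
    hm_add hm_inj hm_pow hm_range hm_surj z hz_p (fun σ => Units.mk0 (b σ) (hb0 σ))
    (IsLocallyConstant.desc _ (Units.val : (AlgebraicClosure K)ˣ → AlgebraicClosure K)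
      (by exact hb_lc) Units.val_injective)
    (fun σ τ => by
      simp only [Units.val_mk0]
      exact hb σ τ)
  -- read `B` in `ℤ/ℓ`
  have hchoice : ∀ x : AddCircle (1 : ℚ), ∃ k : ZMod ℓ, ℓ • x = 0 → e' k = x := fun x => by
    by_cases hx : ℓ • x = 0
    · obtain ⟨k, hk⟩ := he'surj x hx
      exact ⟨k, fun _ => hk⟩
    · exact ⟨0, fun h => absurd h hx⟩
  choose h hh using hchoice
  refine ⟨fun σ => h (B σ), hB_lc.comp h, fun σ τ => he' ?_⟩
  rw [map_sub, map_add, hh _ (hBp σ), hh _ (hBp τ), hh _ (hBp (σ * τ))]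
  exact eq_sub_of_add_eq (hzB σ τ)

end Literature.NumberTheory.GaloisRepresentations.ExplicitMuCocycles

end
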